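import Summits.FinalStateConjecture.FinalStateConjecture.Theorems.ExactKerrEndsCensorshipAlongKerrEndsOfStubs
import Summits.FinalStateConjecture.FinalStateConjecture.Theorems.ExactKerrEndsCensorshipAlongKerrEndsCompactSettledBreathing
import Summits.FinalStateConjecture.FinalStateConjecture.Theorems.ExactKerrEndsCensorshipAlongKerrEndsRadialOfCurve
import Summits.FinalStateConjecture.FinalStateConjecture.Theorems.ExactKerrEndsCensorshipAlongKerrEndsPatchAlongCompactFamily
import HarnessLib

/-!
# Route `ExactKerrEnds`, crux `CensorshipAlongKerrEnds` (stmt-FinalStateConjecture-18521), line `Sketch` v4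
# (compact-support architecture): THE v4 GLUE — the crux from the two COMPACT exits, the sibling crux E's
# fixed-datum atom S1♭, the compact-architecture absorption, and three route items

Second landed composition of line `Sketch` (tree skeleton `Cruxes/CensorshipAlongKerrEnds/Lines/Sketch.lean`, v4; the
v3.5 composition is `…CensorshipAlongKerrEndsOfStubs.lean`, p160948).  Registered sub-goal of the crux item:

* `censorshipAlongKerrEnds_of_compactStubs` —
  `CompactSettledTameAccess → MatchedKerrGluingCurve (E's S1♭ VERBATIM) → ReEndingAbsorptionC → AdmissibleMassNonneg →
   ZeroMassAdmissibleMinkowskian → CensorshipAlongKerrEnds`,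

where compact settled tame access (through every admissible datum passes a tame immersed curve of admissible data, settled
off `0` on a window, which is a COMPACTLY SUPPORTED modification of the base) is itself landed from MGHD existence and the
two SMOOTH COMPACT exits (`…CensorshipAlongKerrEndsCompactAccess.lean`: the summit's settled exits stmt-17383 / stmt-17348
in the weakest witness form — smooth compactly supported admissible deformations with settled small members — registered
stubs of the crux, recommended for promotion).  `MatchedKerrGluingCurve`
is hypothesis 1 of the landed `tameEscapeToKerrEnds_of_matchedKerrGluingCurve_of_nonposMassKerrEnded` (crux E,
stmt-18522), so the ONLY analytic gluing content of `CensorshipAlongKerrEnds` is now E's fixed-datum atom, literally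
shared: the two-parameter glued family is no longer produced by a parametric solution map but by PATCHING one receding
glued family of the fixed base datum along the compactly supported access family (landed `stub_radialOfCurve` p166340
and `stub_patchAlongCompactFamily` p166625, which also make `JointConvergence` / `UniformBound` / the `c`-independence of
the far field THEOREMS).  `ReEndingAbsorptionC` is the physics (asymptotic stability of settled developments under a
receding weighted-small re-ending of the common far field, locally uniformly in `c`; open).

Proof: compact settled access `G` through `F 0`; continuous DR mass `M` of `G`; if `M 0 ≤ 0` the two
positive-mass ITEMS make the base Minkowskian, hence Kerr-ended and censored, and its breathing curve is the answer
(`kerrEndedCensoredSelfWitness`); if `M 0 > 0`: radius-indexed re-ending of `G 0` (S1♭ + `stub_radialOfCurve`), patch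
(`stub_patchAlongCompactFamily`), censoredness on compact bands (physics), select a smooth receding radius (landed
`stub_recedingSelection`), upgrade the window (landed `stub_windowUpgrade`).  No definitions, no named facts.
References: Christodoulou, CQG 16 (1999) A23, p. A24; Corvino, CMP 214 (2000), §4; Corvino–Schoen, JDG 73 (2006),
Thm. 4; Beig–Chruściel, J. Math. Phys. 37 (1996), Thm. 4.1.
-/

-- the summit-side namespace `Summit.FinalStateConjecture.FinalStateConjecture.…` (summit = problem)
-- doubles the `FinalStateConjecture` path component by design; `dupNamespace` would flag every decl.
set_option linter.dupNamespace false

noncomputable section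

open scoped Manifold ContDiff Topology ENNReal
open Set Function Filter TopologicalSpace Literature.Geometry.Lorentzian
open Summit.FinalStateConjecture.FinalStateConjecture.Theses.ExactKerrEnds
  (CensorshipAlongKerrEnds MGHDExists AdmissibleMassNonneg ZeroMassAdmissibleMinkowskian)
open Summit.FinalStateConjecture.FinalStateConjecture.Theorems.SwallowTheDatum.ParametricKerrBurial
  (SmoothSectionsOn AgreeAt)

namespace Summit.FinalStateConjecture.FinalStateConjecture.Theorems.ExactKerrEnds.CensorshipAlongKerrEnds

/-! ## The crux from compact access, E's atom, the absorption and the two positive-mass items -/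

/-- **Registered sub-goal `censorshipAlongKerrEnds_of_compactStubs` of the crux item (stmt-FinalStateConjecture-18521) —
the v4 composition of line `Sketch`: `CensorshipAlongKerrEnds` from compact settled tame access, the sibling crux E's
fixed-datum atom S1♭ (matched Kerr gluing curve, VERBATIM), the compact-architecture absorption (physics) and the two
route items `AdmissibleMassNonneg` / `ZeroMassAdmissibleMinkowskian` BY NAME; the landed `stub_radialOfCurve`,
`stub_patchAlongCompactFamily`, `stub_recedingSelection`, `stub_windowUpgrade` are discharged inside.**
[cite: Christodoulou1999, p. A24] [cite: CorvinoSchoen2006, Thm. 4] [cite: Corvino2000, §4] -/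
theorem censorshipAlongKerrEnds_of_compactStubs : (∀ (X : Type) [TopologicalSpace X] [ChartedSpace E3 X] [IsManifold (𝓡 3) ((⊤ : ℕ∞) : WithTop ℕ∞) X] [T2Space X] [SecondCountableTopology X] [ConnectedSpace X], ∀ d ∈ admissibleVacuumData X, ∃ (e : AFEnd X) (G : EuclideanSpace ℝ (Fin 1) → InitialDataSet (𝓡 3) X), InitialDataSet.IsTameDataFamily e 1 G ∧ InitialDataSet.IsImmersedAtZero 1 G ∧ G 0 = d ∧ (∀ c, G c ∈ admissibleVacuumData X) ∧ (∃ K : Set X, IsCompact K ∧ ∀ (c : EuclideanSpace ℝ (Fin 1)) (x : X), x ∉ K → AgreeAt (G c) d x) ∧ ∃ ε > (0 : ℝ), ∀ c, c ≠ 0 → ‖c‖ < ε → (∃ 𝒟 : VacuumCauchyDevelopment (G c), 𝒟.IsMaximal) ∧ ∀ 𝒟 : VacuumCauchyDevelopment (G c), 𝒟.IsMaximal → HasCompleteNullInfinity 𝒟.toCauchyDevelopment ∧ ∃ (O : Set 𝒟.carrier) (dd : FinalStateDecomposition 𝒟.toSpacetime O 2), (∀ i, Kerr.IsSubextremal (dd.mass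 i) (dd.spin i)) ∧ O = exteriorOf 𝒟.toCauchyDevelopment dd.charted ∧ RaysStayInClosure 𝒟.toCauchyDevelopment O ∧ HasExhaustiveCharts dd ∧ IsFutureOriented dd) → (∀ (X : Type) [TopologicalSpace X] [ChartedSpace E3 X] [IsManifold (𝓡 3) ((⊤ : ℕ∞) : WithTop ℕ∞) X] [T2Space X] [SecondCountableTopology X] [ConnectedSpace X], ∀ [Kerr.Facts], ∀ d ∈ admissibleVacuumData X, ∀ (e : AFEnd X) (M : ℝ), e.IsSoleEnd → 0 < M → e.IsStronglyAsymptoticallyFlatDR d M → ∃ (sstar : ℝ) (ρ m : ℝ → ℝ) (G : ℝ → InitialDataSet (𝓡 3) X), Tendsto ρ atTop atTop ∧ ContinuousOn m (Ioi sstar) ∧ Tendsto m atTop (𝓝 M) ∧ SmoothSectionsOn 𝓘(ℝ, ℝ) G {p : ℝ × X | sstar < p.1} ∧ (∀ s : ℝ, sstar < s → G s ∈ admissibleVacuumData X ∧ (∀ x ∉ e.far (ρ s), AgreeAt (G s) d x) ∧ e.IsStronglyAsymptoticallyFlatDR (G s) (m s) ∧ (G s).HasExactKerrEnd) ∧ Tendsto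 (fun s ↦ e.wDist (G s) d) atTop (𝓝 0)) → (∀ (X : Type) [TopologicalSpace X] [ChartedSpace E3 X] [IsManifold (𝓡 3) ((⊤ : ℕ∞) : WithTop ℕ∞) X] [T2Space X] [SecondCountableTopology X] [ConnectedSpace X], ∀ [Kerr.Facts], ∀ (e : AFEnd X) (G : EuclideanSpace ℝ (Fin 1) → InitialDataSet (𝓡 3) X) (Mf : EuclideanSpace ℝ (Fin 1) → ℝ) (ε Rstar : ℝ) (m : EuclideanSpace ℝ (Fin 1) → ℝ → ℝ) (H : EuclideanSpace ℝ (Fin 1) → ℝ → InitialDataSet (𝓡 3) X), InitialDataSet.IsTameDataFamily e 1 G → (∀ c, G c ∈ admissibleVacuumData X) → Continuous Mf → (∀ c, e.IsStronglyAsymptoticallyFlatDR (G c) (Mf c)) → (∃ K : Set X, IsCompact K ∧ ∀ (c : EuclideanSpace ℝ (Fin 1)) (x : X), x ∉ K → AgreeAt (G c) (G 0) x) → 0 < ε → e.R < Rstar → (∀ c : EuclideanSpace ℝ (Fin 1), c ≠ 0 → ‖c‖ < ε → (∃ 𝒟 : VacuumCauchyDevelopment (G c), 𝒟.IsMaximal)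 ∧ ∀ 𝒟 : VacuumCauchyDevelopment (G c), 𝒟.IsMaximal → HasCompleteNullInfinity 𝒟.toCauchyDevelopment ∧ ∃ (O : Set 𝒟.carrier) (dd : FinalStateDecomposition 𝒟.toSpacetime O 2), (∀ i, Kerr.IsSubextremal (dd.mass i) (dd.spin i)) ∧ O = exteriorOf 𝒟.toCauchyDevelopment dd.charted ∧ RaysStayInClosure 𝒟.toCauchyDevelopment O ∧ HasExhaustiveCharts dd ∧ IsFutureOriented dd) → GluedStructure e G ε Rstar m H → (∀ (c : EuclideanSpace ℝ (Fin 1)) (R : ℝ), ‖c‖ < ε → Rstar < R → H c R ∈ admissibleVacuumData X ∧ (H c R).HasExactKerrEnd) → (∀ (c c' : EuclideanSpace ℝ (Fin 1)) (R : ℝ), ∀ x ∈ e.far Rstar, AgreeAt (H c R) (H c' R) x) → (∀ c : EuclideanSpace ℝ (Fin 1), ‖c‖ < ε → Tendsto (fun R ↦ e.wDist (H c R) (G c)) atTop (𝓝 0)) → JointConvergence e G Mf ε Rstar m H → UniformBound e G ε Rstar H → EventuallyOnBands (fun D ↦ ∀ 𝒟 : VacuumCauchyDevelopment D, 𝒟.IsMaximal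 → HasCompleteNullInfinity 𝒟.toCauchyDevelopment) ε Rstar H) → AdmissibleMassNonneg → ZeroMassAdmissibleMinkowskian → CensorshipAlongKerrEnds := by
  intro hA hcurve habs hP hZ X _ _ _ _ _ _ KerrEnded' Censored' e F hF hshape hadm hKE
  have hd : F 0 ∈ admissibleVacuumData X := hadm 0
  obtain ⟨e₁, G, hGt, hGi, hG0, hGadm, hGcpt, ε, hε, hGset⟩ := hA X (F 0) hd
  obtain ⟨Mf, hMf, hDR⟩ := hGt.2.2.1
  have hsole : e₁.IsSoleEnd := hGt.2.1
  have hGcpt' : ∃ K : Set X, IsCompact K ∧ ∀ (c : EuclideanSpace ℝ (Fin 1)) (x : X), x ∉ K → AgreeAt (G c) (G 0) x := by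
    rw [hG0]; exact hGcpt
  by_cases hpos : 0 < Mf 0
  · -- gluing branch
    haveI : Kerr.Facts := SwallowTheDatum.kerrFacts
    -- radius-indexed receding re-ending of the base (E's atom + landed `stub_radialOfCurve`), patched along `G`
    obtain ⟨Rs₁, m₁, Gh, hRs₁, hm₁, hm₁M, hGh, hGhmem, hGhw⟩ :=
      stub_radialOfCurve hcurve X (G 0) (hGadm 0) e₁ (Mf 0) hsole hpos (hDR 0)
    obtain ⟨ε₀, Rstar, m, H, hε₀, hRstar, hstr, hmem, hfarc, hpt, hjoint, hbd⟩ :=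
      stub_patchAlongCompactFamily X e₁ G Mf hGt hGadm hMf hDR hGcpt'
        ⟨Rs₁, m₁, Gh, hRs₁, hm₁, hm₁M, hGh, hGhmem, hGhw⟩
    set ε₂ : ℝ := min ε ε₀ with hε₂def
    have hε₂ : 0 < ε₂ := lt_min hε hε₀
    have hε₂ε : ε₂ ≤ ε := min_le_left _ _
    have hε₂ε₀ : ε₂ ≤ ε₀ := min_le_right _ _
    have hstr₂ : GluedStructure e₁ G ε₂ Rstar m H := hstr.mono hε₂ε₀
    have hjoint₂ : JointConvergence e₁ G Mf ε₂ Rstar m H := hjoint.mono hε₂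
    have hbd₂ : UniformBound e₁ G ε₂ Rstar H := hbd.mono hε₂ε₀
    have hmem₂ : ∀ (c : EuclideanSpace ℝ (Fin 1)) (R : ℝ), ‖c‖ < ε₂ → Rstar < R →
        H c R ∈ admissibleVacuumData X ∧ (H c R).HasExactKerrEnd :=
      fun c R hc hR ↦ hmem c R (lt_of_lt_of_le hc hε₂ε₀) hR
    have hpt₂ : ∀ c : EuclideanSpace ℝ (Fin 1), ‖c‖ < ε₂ →
        Tendsto (fun R ↦ e₁.wDist (H c R) (G c)) atTop (𝓝 0) :=
      fun c hc ↦ hpt c (lt_of_lt_of_le hc hε₂ε₀)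
    -- physics: censoredness of the re-ended members on compact bands
    have hcens : EventuallyOnBands
        (fun D ↦ ∀ 𝒟 : VacuumCauchyDevelopment D, 𝒟.IsMaximal → HasCompleteNullInfinity 𝒟.toCauchyDevelopment)
        ε₂ Rstar H :=
      habs X e₁ G Mf ε₂ Rstar m H hGt hGadm hMf hDR hGcpt' hε₂ hRstar
        (fun c hc hcε ↦ hGset c hc (lt_of_lt_of_le hcε hε₂ε)) hstr₂ hmem₂ hfarc hpt₂ hjoint₂ hbd₂
    -- the property to be selected: admissible ∧ Kerr-ended ∧ censored
    have hPsel : EventuallyOnBands (fun D ↦ D ∈ admissibleVacuumData X ∧ D.HasExactKerrEnd ∧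
        ∀ 𝒟 : VacuumCauchyDevelopment D, 𝒟.IsMaximal → HasCompleteNullInfinity 𝒟.toCauchyDevelopment)
        ε₂ Rstar H := by
      intro C hC h0 hCε
      obtain ⟨R₂, hR₂, hR₂P⟩ := hcens C hC h0 hCε
      refine ⟨R₂, hR₂, fun c hc R hR ↦ ?_⟩
      have hcε : ‖c‖ < ε₂ := by simpa using hCε hc
      have hRstarR : Rstar < R := lt_of_le_of_lt hR₂ hR
      obtain ⟨hadm', hKE''⟩ := hmem₂ c R hcε hRstarR
      exact ⟨hadm', @hKE'', hR₂P c hc R hR⟩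
    -- bookkeeping: select a smooth receding radius (landed `stub_recedingSelection`)
    obtain ⟨F', hF't, hF'i, hF'0, ε', hε', hF'P⟩ :=
      stub_recedingSelection X (fun D ↦ D ∈ admissibleVacuumData X ∧ D.HasExactKerrEnd ∧
          ∀ 𝒟 : VacuumCauchyDevelopment D, 𝒟.IsMaximal → HasCompleteNullInfinity 𝒟.toCauchyDevelopment)
        e₁ G Mf ε₂ Rstar m H hGt hGi hMf hDR hε₂ hRstar hstr₂ hjoint₂ hPsel
    -- window upgrade (landed `stub_windowUpgrade`)
    obtain ⟨F'', hF''t, hF''0, hF''inj, hF''i, hF''P⟩ :=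
      stub_windowUpgrade X (fun D ↦ D ∈ admissibleVacuumData X ∧ D.HasExactKerrEnd ∧
          ∀ 𝒟 : VacuumCauchyDevelopment D, 𝒟.IsMaximal → HasCompleteNullInfinity 𝒟.toCauchyDevelopment)
        e₁ F' hF't hF'i ⟨ε', hε', hF'P⟩
    refine ⟨e₁, F'', hF''t, hF''0.trans (hF'0.trans hG0), hF''inj, hF''i, ?_, ?_⟩
    · intro c
      by_cases hc : c = 0
      · subst hc
        rw [hF''0, hF'0, hG0]
        exact hd
      · exact (hF''P c hc).1
    · intro c hc
      exact ⟨(hF''P c hc).2.1, (hF''P c hc).2.2⟩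
  · -- flat base branch: the base datum is Minkowskian, hence Kerr-ended and censored; breathe it
    have hle : Mf 0 ≤ 0 := not_lt.mp hpos
    obtain ⟨𝒟, h𝒟⟩ := exists_cauchyDevelopment_eq_minkowski_of_items hP hZ (hGadm 0) hsole hle (hDR 0)
    have hKE0 : (F 0).HasExactKerrEnd := by
      rw [← hG0]
      exact hasExactKerrEnd_of_cauchyDevelopment_eq_minkowski X (G 0) e₁ hsole 𝒟 h𝒟
    have hC0 : ∀ 𝒟' : VacuumCauchyDevelopment (F 0), 𝒟'.IsMaximal →
        HasCompleteNullInfinity 𝒟'.toCauchyDevelopment := by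
      rw [← hG0]
      exact censored_of_cauchyDevelopment_eq_minkowski X (G 0) 𝒟 h𝒟
    obtain ⟨e', F', hF't, hF'0, hF'inj, hF'i, hF'adm, hgood⟩ := kerrEndedCensoredSelfWitness hd hKE0 hC0
    exact ⟨e', F', hF't, hF'0, hF'inj, hF'i, hF'adm, fun c _ ↦ ⟨(hgood c).1, (hgood c).2⟩⟩

end Summit.FinalStateConjecture.FinalStateConjecture.Theorems.ExactKerrEnds.CensorshipAlongKerrEnds

end
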